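import Summits.BirchSwinnertonDyer.BirchSwinnertonDyer.Theorems.CumulativeHeegnerLeopoldtCumulativeHeegnerInclusionAtThreeUnrSeriesDomination
import Summits.BirchSwinnertonDyer.BirchSwinnertonDyer.Theorems.CumulativeHeegnerLeopoldtCumulativeHeegnerInclusionAtThreeStubThreeSaturation
import HarnessLib

/-!
# Crux K1 `CumulativeHeegnerInclusionAtThree` (stmt-BirchSwinnertonDyer-24198), line `birth` — STUB A
# (= crux stmt-BirchSwinnertonDyer-26896 `TemperedHeegnerInclusionAtThree`): the TEMPERED values currency —
# domination `‖L(x)‖ ≤ C_ρ · ‖g(x)‖` on every CLOSED sub-ball `‖x‖ ≤ ρ < 1` of the open unit disc of `ℂ_p`,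
# with constants allowed to blow up toward the rim, already gives `∃ μ, p^μ · L ∈ (g)` in `Λ^ur = R₀⟦T⟧`

Lead prover bsd-line-chl-k1-p1 g4 (`--supports stmt-BirchSwinnertonDyer-24198`), sequel of the width seat's
`…UnrSeriesDomination` (uniform constant on a dense set) and `…UnrSeriesDominationSharp` (constant `1`).

WHY. Stub A of the line (= child crux 26896) is the RATIONAL divisibility `∃ μ, span{3^μ · L} ≤ Ch · R₀⟦T⟧`.
At the additive prime `3` the Heegner norm points are TRACE-ZERO up the anticyclotomic tower, so there is no
integral norm-compatible Λ-adic Heegner class (`…TraceZeroHeegnerModule.heegnerModule_eq_bot_of_traceZero`,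
p621811) and the natural object is a TEMPERED class (the cumulative class has temper exactly `1`:
`…TraceZeroHeegnerModule.sum_conjPi_cumulative_succ_eq_resPi_smul`, p622174; `…GammaBallSystem`, p619789).
A Kolyvagin-system argument run with a tempered (`𝓗₁`-valued) class delivers its bound specialisation by
specialisation with a defect that depends on the RADIUS of the specialisation only: at every point `x` of the
closed ball `‖x‖ ≤ ρ` (off finitely many exceptional `x`) one gets `‖L(x)‖ ≤ C_ρ · ‖g(x)‖`, with `C_ρ → ∞`
as `ρ → 1⁻` (the denominators needed to make the specialised class integral grow toward the rim). The
recorded objection to tempered classes («temper 1 is critical: an order-1 distribution is not determined by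
its values at finite-order characters», evidence #28 §3 on 24198; memo BARRIER-MEMO-A26896 (R2)) concerns
IDENTIFYING a tempered function from values at the torsion points `ζ − 1`, which tend to the rim. It does NOT
obstruct stub A: the zeros of a non-zero element of `R₀⟦T⟧` are FINITELY many and INTERIOR (Weierstrass
preparation over the discrete valuation ring `R₀`), so domination on ONE closed ball containing them already
forces the rational divisibility. This file proves exactly that, for every prime `p`:

* §1 `exists_lt_one_forall_le`: finitely many reals `< 1` and one more `b < 1` have a common bound `ρ < 1`;
  `mem_closure_closedBall_diff_finite`: a closed ball `‖x‖ ≤ ρ` with `‖p‖ ≤ ρ` minus a finite set is dense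
  in the ball (`a = lim (a + p^{n+1})`).
* §2 `eq_zero_of_norm_eval_le_prod_on_closedBall`: a polynomial over `ℂ_p` of degree `< d` dominated on a
  closed ball `‖x‖ ≤ ρ` (`‖p‖ ≤ ρ`) containing `α_1, …, α_d` by `C · ∏ ‖x − α_i‖` is ZERO (root by root,
  the bound at a removed root being recovered by continuity and §1).
* §3 **`exists_C_pow_mul_mem_span_of_norm_value_le_on_closedBalls`**: for `g ≠ 0` and `L` in `R₀⟦T⟧`, if for
  every `ρ < 1` there are a finite set `F_ρ` and a constant `C_ρ` with `‖L(x)‖ ≤ C_ρ · ‖g(x)‖` for all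
  `‖x‖ ≤ ρ`, `x ∉ F_ρ`, then `p^μ · L ∈ (g)` for some `μ` (the `p`-content of `g`). Proof: `g = p^a · P · U`,
  `L = (P U) q + r` with `deg r < deg P` (Mathlib Weierstrass preparation / division over the complete DVR
  `R₀`); take ONE radius `ρ < 1` beyond `‖p‖` and all roots of `P` (§1); on that ball `‖r(x)‖ ≤ C' ‖P(x)‖`
  (off `F_ρ`, then everywhere by density), so `r = 0` (§2) and `p^a L = q U⁻¹ g`. The packaging
  **`exists_C_pow_mul_mem_span_iff_norm_value_le_on_closedBalls`** (with the width seat's converse) and the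
  stub-A-shaped `exists_span_pow_mul_le_of_norm_value_le_on_closedBalls` (`∃ μ, span{p^μ · L} ≤ J` for any
  ideal `J ∋ g`).
* §4 (`p = 3`, K1's own `μ`-free currency) `span_le_of_norm_value_le_on_closedBalls_of_norm_coeff_eq_one`:
  if moreover `J = (g)` with `g` having a coefficient of norm `1` (the output of the line's stub B on the
  Leopoldt cell), then `span{L} ≤ J` — tempered domination + `μ(g) = 0` + saturation (stub C, p595383).

HONEST FRAMING: pure `p`-adic algebra on the receptacle `R₀⟦T⟧`; no Kolyvagin system, reciprocity law,
Selmer group or `L`-function is constructed or asserted; closes nothing by itself (the tempered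
Kolyvagin-system bound at additive `3` with reducible `E[3]` — crux 26896 — is not in print). No
definition, no named fact, no `sorry`. BSD is not proved by any of this; no summit statement is proved by
this seat.

References: [Washington1997] §7.1 Prop. 7.2, Thm. 7.3 (Weierstrass preparation and division in `𝔬⟦T⟧`);
[Lang1990] Ch. 5 §2; route-BirchSwinnertonDyer-CumulativeHeegnerLeopoldt, crux K1 / A (stmt-24198 / 26896).
-/

set_option autoImplicit false
-- `…BirchSwinnertonDyer.BirchSwinnertonDyer.Theorems…` is the problem's mandated namespace (D-0017).
set_option linter.dupNamespace false

noncomputable section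

open scoped Classical

open Filter Topology PowerSeries Literature.NumberTheory.EllipticCurves
  Summit.BirchSwinnertonDyer.Rank1Residual.X11b.Halves
  Summit.BirchSwinnertonDyer.Rank1Residual.X2.HidaLimitAlgebra
  Summit.BirchSwinnertonDyer.BirchSwinnertonDyer.Theorems.CongruentShaFreeCutUnrSeriesWeierstrass
  Summit.BirchSwinnertonDyer.BirchSwinnertonDyer.Theorems.CumulativeHeegnerInclusionAtThreeUnrSeriesZeros
  Summit.BirchSwinnertonDyer.BirchSwinnertonDyer.Theorems.CumulativeHeegnerInclusionAtThreeUnrSeriesDomination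

open Summit.BirchSwinnertonDyer.BirchSwinnertonDyer.Theorems.CongruentShaFreeCutBDPUpToPowerMapIdentity
  (hasValueAt_sub hasValueAt_add)
open Summit.BirchSwinnertonDyer.BirchSwinnertonDyer.Theorems.CongruentShaFreeCutPadicSupplyRate
  (norm_value_le_one)

namespace Summit.BirchSwinnertonDyer.BirchSwinnertonDyer.Theorems.CumulativeHeegnerInclusionAtThreeUnrSeriesTemperedDomination

variable {p : ℕ} [hp : Fact p.Prime]

/-! ### §1 A common radius `ρ < 1`; density of a closed ball minus a finite set -/

/-- Finitely many real numbers `< 1` together with one more `b < 1` admit a common upper bound `ρ < 1`.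
[folklore] -/
theorem exists_lt_one_forall_le (T : Finset ℝ) (hT : ∀ t ∈ T, t < 1) {b : ℝ} (hb : b < 1) :
    ∃ ρ : ℝ, ρ < 1 ∧ b ≤ ρ ∧ ∀ t ∈ T, t ≤ ρ := by
  rcases T.eq_empty_or_nonempty with hTe | hTne
  · exact ⟨b, hb, le_rfl, fun t ht ↦ by simp [hTe] at ht⟩
  · refine ⟨max b (T.max' hTne), max_lt hb ((Finset.max'_lt_iff T hTne).mpr hT), le_max_left _ _,
      fun t ht ↦ (T.le_max' t ht).trans (le_max_right _ _)⟩

/-- **A closed ball `‖x‖ ≤ ρ` of `ℂ_p` with `‖p‖ ≤ ρ`, minus a finite set, is dense in the ball**: every `a`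
with `‖a‖ ≤ ρ` is the limit of `a + p^{n+1}` (all of norm `≤ ρ`), and only finitely many of these lie in the
finite set `F`. (Closed-ball twin of `…UnrSeriesDomination.mem_closure_disc_diff_finite`.) [folklore] -/
theorem mem_closure_closedBall_diff_finite {F : Set ℂ_[p]} (hF : F.Finite) {ρ : ℝ}
    (hρ : ‖(p : ℂ_[p])‖ ≤ ρ) {a : ℂ_[p]} (ha : ‖a‖ ≤ ρ) :
    a ∈ closure {x : ℂ_[p] | ‖x‖ ≤ ρ ∧ x ∉ F} := by
  have hp0 : (p : ℂ_[p]) ≠ 0 := by exact_mod_cast hp.out.ne_zero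
  have hplt : ‖(p : ℂ_[p])‖ < 1 := norm_prime_padicComplex_lt_one
  set u : ℕ → ℂ_[p] := fun n ↦ a + (p : ℂ_[p]) ^ (n + 1) with hu
  have hten : Tendsto u atTop (𝓝 a) := by
    have h0 : Tendsto (fun n : ℕ ↦ (p : ℂ_[p]) ^ (n + 1)) atTop (𝓝 0) :=
      (tendsto_pow_atTop_nhds_zero_of_norm_lt_one hplt).comp (tendsto_add_atTop_nat 1)
    simpa using tendsto_const_nhds.add h0
  refine mem_closure_of_tendsto hten ?_
  have hinj : Function.Injective u := by
    intro m n hmn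
    have h1 : (p : ℂ_[p]) ^ (m + 1) = (p : ℂ_[p]) ^ (n + 1) := add_left_cancel hmn
    have h2 : ‖(p : ℂ_[p])‖ ^ (m + 1) = ‖(p : ℂ_[p])‖ ^ (n + 1) := by
      rw [← norm_pow, ← norm_pow, h1]
    have h3 := pow_right_injective₀ (norm_pos_iff.mpr hp0) hplt.ne h2
    omega
  have hfin : {n : ℕ | u n ∈ F}.Finite := hF.preimage hinj.injOn
  have hev : ∀ᶠ n in atTop, u n ∉ F := by
    rw [← Nat.cofinite_eq_atTop]
    exact hfin.compl_mem_cofinite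
  filter_upwards [hev] with n hn
  refine ⟨?_, hn⟩
  have hpn : ‖(p : ℂ_[p]) ^ (n + 1)‖ ≤ ρ := by
    rw [norm_pow]
    exact (pow_le_of_le_one (norm_nonneg _) hplt.le (by omega)).trans hρ
  calc ‖a + (p : ℂ_[p]) ^ (n + 1)‖ ≤ max ‖a‖ ‖(p : ℂ_[p]) ^ (n + 1)‖ :=
        IsUltrametricDist.norm_add_le_max _ _
    _ ≤ ρ := max_le ha hpn

/-! ### §2 A low-degree polynomial dominated by `∏ ‖x − α_i‖` on a closed ball containing the `α_i` is zero -/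

/-- **A polynomial of degree `< d` dominated on the closed ball `‖x‖ ≤ ρ` (`‖p‖ ≤ ρ`) by
`C · ∏_{i<d} ‖x − α_i‖` with all `‖α_i‖ ≤ ρ` is zero**: at `x = α_1` it vanishes, so `r = (T − α_1) r_1`;
off `α_1` the quotient `r_1` is dominated by the remaining product, at `α_1` too by continuity and the
density of §1; induct on `d`. (Closed-ball twin of `…UnrSeriesDomination.eq_zero_of_norm_eval_le_prod`: only
the ball containing the roots matters.) [cite: Washington1997, §7.1] -/
theorem eq_zero_of_norm_eval_le_prod_on_closedBall {C ρ : ℝ} (hρ : ‖(p : ℂ_[p])‖ ≤ ρ)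
    (s : Multiset ℂ_[p]) (hs : ∀ a ∈ s, ‖a‖ ≤ ρ) (r : Polynomial ℂ_[p])
    (hr : r.degree < (Multiset.card s : ℕ))
    (hdom : ∀ x : ℂ_[p], ‖x‖ ≤ ρ →
      ‖r.eval x‖ ≤ C * ‖((s.map fun a ↦ Polynomial.X - Polynomial.C a).prod).eval x‖) :
    r = 0 := by
  induction s using Multiset.induction_on generalizing r with
  | empty =>
    rw [Multiset.card_zero, Nat.cast_zero, Nat.WithBot.lt_zero_iff, Polynomial.degree_eq_bot] at hr
    exact hr
  | cons a s ih =>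
    have ha : ‖a‖ ≤ ρ := hs a (Multiset.mem_cons_self a s)
    have hs' : ∀ b ∈ s, ‖b‖ ≤ ρ := fun b hb ↦ hs b (Multiset.mem_cons_of_mem hb)
    set Q : Polynomial ℂ_[p] := (s.map fun a ↦ Polynomial.X - Polynomial.C a).prod with hQ
    have hprod : ((a ::ₘ s).map fun a ↦ Polynomial.X - Polynomial.C a).prod =
        (Polynomial.X - Polynomial.C a) * Q := by
      rw [Multiset.map_cons, Multiset.prod_cons]
    -- `r(a) = 0`
    have hra : r.IsRoot a := by
      have h := hdom a ha
      rw [hprod, Polynomial.eval_mul, Polynomial.eval_sub, Polynomial.eval_X, Polynomial.eval_C,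
        sub_self, zero_mul, norm_zero, mul_zero] at h
      exact norm_le_zero_iff.mp h
    obtain ⟨r₁, hr₁⟩ : (Polynomial.X - Polynomial.C a) ∣ r := Polynomial.dvd_iff_isRoot.mpr hra
    by_cases hr₁0 : r₁ = 0
    · rw [hr₁, hr₁0, mul_zero]
    have hXa : (Polynomial.X - Polynomial.C a) ≠ 0 := Polynomial.X_sub_C_ne_zero a
    have hr0 : r ≠ 0 := by rw [hr₁]; exact mul_ne_zero hXa hr₁0
    have hdeg₁ : r₁.degree < (Multiset.card s : ℕ) := by
      rw [← Polynomial.natDegree_lt_iff_degree_lt hr₁0]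
      have h1 : r.natDegree < Multiset.card (a ::ₘ s) :=
        (Polynomial.natDegree_lt_iff_degree_lt hr0).mpr hr
      rw [Multiset.card_cons, hr₁, Polynomial.natDegree_mul hXa hr₁0, Polynomial.natDegree_X_sub_C]
        at h1
      omega
    -- domination of `r₁` off `a`, then at `a` by density inside the ball
    have hdom₁' : ∀ x ∈ {x : ℂ_[p] | ‖x‖ ≤ ρ ∧ x ∉ ({a} : Set ℂ_[p])},
        ‖r₁.eval x‖ ≤ C * ‖Q.eval x‖ := by
      rintro x ⟨hx, hxa⟩
      have hxa' : x - a ≠ 0 := sub_ne_zero.mpr hxa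
      have hpos : 0 < ‖x - a‖ := norm_pos_iff.mpr hxa'
      have h := hdom x hx
      rw [hprod, hr₁, Polynomial.eval_mul, Polynomial.eval_mul, Polynomial.eval_sub, Polynomial.eval_X,
        Polynomial.eval_C, norm_mul, norm_mul, ← mul_assoc, mul_comm C, mul_assoc] at h
      exact le_of_mul_le_mul_left h hpos
    have hdom₁ : ∀ x : ℂ_[p], ‖x‖ ≤ ρ → ‖r₁.eval x‖ ≤ C * ‖Q.eval x‖ := fun x hx ↦
      norm_eval_le_on_closure hdom₁' (mem_closure_closedBall_diff_finite (Set.finite_singleton a) hρ hx)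
    have h := ih hs' r₁ hdeg₁ hdom₁
    exact absurd h hr₁0

/-! ### §3 TEMPERED domination ⟹ divisibility up to `p^μ` in `R₀⟦T⟧` -/

/-- **Tempered domination ⟹ divisibility up to a power of `p`.** Let `g ≠ 0` and `L` be elements of
`Λ^ur = R₀⟦T⟧`. Suppose that for every radius `ρ < 1` there are a finite set `F_ρ ⊆ ℂ_p` and a constant `C_ρ`
such that `‖L(x)‖ ≤ C_ρ · ‖g(x)‖` for every `x` with `‖x‖ ≤ ρ`, `x ∉ F_ρ` — the constants being allowed to
blow up as `ρ → 1⁻`, which is the shape of a Kolyvagin-system bound obtained from a TEMPERED (`𝓗₁`-valued)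
Λ-adic class. Then `p^μ · L ∈ (g)` for some `μ : ℕ` (namely the `p`-content of `g`). Proof: `g = p^a · P · U`
(`p`-content + Weierstrass preparation over the complete DVR `R₀`), `L = (P U) q + r` with `deg r < deg P`
(Weierstrass division); ONE radius `ρ < 1` beyond `‖p‖` and all (finitely many, interior) roots of `P`
suffices: on that ball `‖r(x)‖ ≤ (max C_ρ 0 + 1) · ‖P(x)‖` off `F_ρ`, hence everywhere on the ball by density,
so `r = 0` (§2) and `p^a L = q · U⁻¹ · g`. [cite: Washington1997, §7.1 Prop. 7.2, Thm. 7.3] -/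
theorem exists_C_pow_mul_mem_span_of_norm_value_le_on_closedBalls {g L : UnrSeries p} (hg : g ≠ 0)
    (hdom : ∀ ρ : ℝ, ρ < 1 → ∃ (F : Set ℂ_[p]) (C : ℝ), F.Finite ∧
      ∀ x : ℂ_[p], x ∉ F → ‖x‖ ≤ ρ → ∀ u v : ℂ_[p], g.HasValueAt x u → L.HasValueAt x v →
        ‖v‖ ≤ C * ‖u‖) :
    ∃ μ : ℕ, PowerSeries.C (((p : ℕ) : unrIntegers p) ^ μ) * L ∈ Ideal.span {g} := by
  haveI := isDiscreteValuationRing_unrIntegers (p := p)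
  haveI : IsAdicComplete (IsLocalRing.maximalIdeal (unrIntegers p)) (unrIntegers p) :=
    isAdicComplete_maximalIdeal
  obtain ⟨a, g₀, hga, hg₀⟩ := UnrSeries.exists_eq_C_pow_mul_map_residue_ne_zero hg
  obtain ⟨P, U, H⟩ := g₀.exists_isWeierstrassFactorization hg₀
  obtain ⟨q, r, HD⟩ := L.exists_isWeierstrassDivision hg₀
  have hLeq : L = g₀ * q + (r : UnrSeries p) := HD.eq_mul_add
  have hdegr : r.degree < (P.natDegree : ℕ) := by rw [H.natDegree_eq_toNat_order_map]; exact HD.degree_lt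
  set Pc : Polynomial ℂ_[p] := P.map (unrIntegers p).subtype with hPc
  set rc : Polynomial ℂ_[p] := r.map (unrIntegers p).subtype with hrc
  have hinj : Function.Injective (unrIntegers p).subtype := Subtype.coe_injective
  have hPmo : Pc.Monic := H.isDistinguishedAt.monic.map _
  have hPdeg : Pc.natDegree = P.natDegree := Polynomial.natDegree_map_eq_of_injective hinj P
  have hrdeg : rc.degree = r.degree := Polynomial.degree_map_eq_of_injective hinj r
  -- norm of `p^a`
  have hpa : ‖((((p : ℕ) : unrIntegers p) ^ a : unrIntegers p) : ℂ_[p])‖ ≤ 1 :=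
    norm_coe_unrIntegers_le_one p _
  -- the roots of `Pc`: finitely many, all in the open disc
  have hroots : Multiset.card Pc.roots = Pc.natDegree :=
    (IsAlgClosed.splits Pc).natDegree_eq_card_roots.symm
  have hPprod : (Pc.roots.map fun a ↦ Polynomial.X - Polynomial.C a).prod = Pc :=
    Polynomial.prod_multiset_X_sub_C_of_monic_of_roots_card_eq hPmo hroots
  have hcoef : ∀ k < Pc.natDegree, ‖Pc.coeff k‖ < 1 := by
    intro k hk
    rw [hPc, Polynomial.coeff_map, Subring.subtype_apply]
    exact norm_lt_one_of_mem_maximalIdeal (H.isDistinguishedAt.mem (by rwa [hPdeg] at hk))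
  have hrootsdisc : ∀ α ∈ Pc.roots, ‖α‖ < 1 := fun α hα ↦
    norm_root_lt_one hPmo hcoef ((Polynomial.mem_roots hPmo.ne_zero).mp hα)
  -- ONE radius `ρ < 1` beyond `‖p‖` and all roots
  have hplt : ‖(p : ℂ_[p])‖ < 1 := norm_prime_padicComplex_lt_one
  obtain ⟨ρ, hρ1, hpρ, hTρ⟩ := exists_lt_one_forall_le ((Pc.roots.map fun α ↦ ‖α‖).toFinset)
    (fun t ht ↦ by
      obtain ⟨α, hα, rfl⟩ := Multiset.mem_map.mp (Multiset.mem_toFinset.mp ht)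
      exact hrootsdisc α hα) hplt
  have hrootsρ : ∀ α ∈ Pc.roots, ‖α‖ ≤ ρ := fun α hα ↦
    hTρ ‖α‖ (Multiset.mem_toFinset.mpr (Multiset.mem_map.mpr ⟨α, hα, rfl⟩))
  obtain ⟨F, C, hF, hC⟩ := hdom ρ hρ1
  -- STEP 1: `‖r(x)‖ ≤ C' ‖P(x)‖` on the ball minus `F`
  set C' : ℝ := max C 0 + 1 with hC'
  have hstep : ∀ x ∈ {y : ℂ_[p] | ‖y‖ ≤ ρ ∧ y ∉ F}, ‖rc.eval x‖ ≤ C' * ‖Pc.eval x‖ := by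
    rintro x ⟨hxρ, hxF⟩
    have hx : ‖x‖ < 1 := lt_of_le_of_lt hxρ hρ1
    obtain ⟨u, hu⟩ := exists_hasValueAt U hx
    obtain ⟨w, hw⟩ := exists_hasValueAt q hx
    have hP : UnrSeries.HasValueAt (P : UnrSeries p) x (Pc.eval x) := hasValueAt_coe_polynomial P x
    have hr : UnrSeries.HasValueAt (r : UnrSeries p) x (rc.eval x) := hasValueAt_coe_polynomial r x
    have hg₀v : UnrSeries.HasValueAt g₀ x (Pc.eval x * u) := by
      rw [H.eq_mul]; exact hasValueAt_mul hx hP hu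
    have hgv : UnrSeries.HasValueAt g x
        (((((p : ℕ) : unrIntegers p) ^ a : unrIntegers p) : ℂ_[p]) * (Pc.eval x * u)) := by
      rw [hga]; exact hasValueAt_C_mul _ hg₀v
    have hLv : UnrSeries.HasValueAt L x (Pc.eval x * u * w + rc.eval x) := by
      rw [hLeq]; exact hasValueAt_add (hasValueAt_mul hx hg₀v hw) hr
    have hd := hC x hxF hxρ _ _ hgv hLv
    have hu1 : ‖u‖ = 1 := norm_value_eq_one_of_isUnit H.isUnit hx hu
    have hw1 : ‖w‖ ≤ 1 := norm_value_le_one hx hw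
    have hgn : ‖((((p : ℕ) : unrIntegers p) ^ a : unrIntegers p) : ℂ_[p]) * (Pc.eval x * u)‖ ≤
        ‖Pc.eval x‖ := by
      rw [norm_mul, norm_mul, hu1, mul_one]
      exact mul_le_of_le_one_left (norm_nonneg _) hpa
    have h1 : ‖Pc.eval x * u * w + rc.eval x‖ ≤ max C 0 * ‖Pc.eval x‖ :=
      hd.trans ((mul_le_mul_of_nonneg_right (le_max_left C 0) (norm_nonneg _)).trans
        (mul_le_mul_of_nonneg_left hgn (le_max_right C 0)))
    have h2 : ‖Pc.eval x * u * w‖ ≤ ‖Pc.eval x‖ := by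
      rw [norm_mul, norm_mul, hu1, mul_one]
      exact mul_le_of_le_one_right (norm_nonneg _) hw1
    calc ‖rc.eval x‖ = ‖(Pc.eval x * u * w + rc.eval x) - Pc.eval x * u * w‖ := by
          rw [add_sub_cancel_left]
      _ ≤ ‖Pc.eval x * u * w + rc.eval x‖ + ‖Pc.eval x * u * w‖ := norm_sub_le _ _
      _ ≤ max C 0 * ‖Pc.eval x‖ + ‖Pc.eval x‖ := add_le_add h1 h2
      _ = C' * ‖Pc.eval x‖ := by rw [hC']; ring
  -- STEP 2: extend to the whole closed ball by density
  have hball : ∀ x : ℂ_[p], ‖x‖ ≤ ρ → ‖rc.eval x‖ ≤ C' * ‖Pc.eval x‖ := fun x hx ↦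
    norm_eval_le_on_closure hstep (mem_closure_closedBall_diff_finite hF hpρ hx)
  -- STEP 3: kill `rc` on the ball containing the roots
  have hrc0 : rc = 0 := by
    refine eq_zero_of_norm_eval_le_prod_on_closedBall (C := C') hpρ Pc.roots hrootsρ rc ?_ ?_
    · rw [hroots, hPdeg, hrdeg]; exact hdegr
    · intro x hx
      rw [hPprod]
      exact hball x hx
  have hr0 : r = 0 := (Polynomial.map_eq_zero_iff hinj).mp hrc0
  -- STEP 4: `p^a · L = q · g`
  refine ⟨a, Ideal.mem_span_singleton'.mpr ⟨q, ?_⟩⟩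
  rw [hLeq, hr0, Polynomial.coe_zero, add_zero, hga]
  ring

/-- **Divisibility up to a power of `p` ⟺ TEMPERED domination.** For `g ≠ 0` and `L` in `Λ^ur = R₀⟦T⟧`:
`∃ μ, p^μ · L ∈ (g)` iff for every `ρ < 1` there are a finite `F_ρ` and `C_ρ` with `‖L(x)‖ ≤ C_ρ · ‖g(x)‖` for
`‖x‖ ≤ ρ`, `x ∉ F_ρ` (the converse direction holds with the uniform constant `p^μ` and `F = ∅`, width seat's
`norm_value_le_of_C_pow_mul_mem_span`). Compare `…UnrSeriesDomination.exists_C_pow_mul_mem_span_iff_norm_value_le`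
(UNIFORM constant on the whole disc): the tempered hypothesis is the weaker one. [cite: Washington1997, §7.1 Thm. 7.3] -/
theorem exists_C_pow_mul_mem_span_iff_norm_value_le_on_closedBalls {g L : UnrSeries p} (hg : g ≠ 0) :
    (∃ μ : ℕ, PowerSeries.C (((p : ℕ) : unrIntegers p) ^ μ) * L ∈ Ideal.span {g}) ↔
      ∀ ρ : ℝ, ρ < 1 → ∃ (F : Set ℂ_[p]) (C : ℝ), F.Finite ∧
        ∀ x : ℂ_[p], x ∉ F → ‖x‖ ≤ ρ → ∀ u v : ℂ_[p], g.HasValueAt x u → L.HasValueAt x v →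
          ‖v‖ ≤ C * ‖u‖ := by
  constructor
  · rintro ⟨μ, hμ⟩ ρ hρ
    exact ⟨∅, (p : ℝ) ^ μ, Set.finite_empty, fun x _ hx u v hu hv ↦
      norm_value_le_of_C_pow_mul_mem_span hμ (lt_of_le_of_lt hx hρ) hu hv⟩
  · exact exists_C_pow_mul_mem_span_of_norm_value_le_on_closedBalls hg

/-- **Stub-A-shaped corollary** (the conclusion `∃ μ, span{p^μ · L} ≤ J` of crux 26896, for an ideal `J` of
`R₀⟦T⟧` containing a non-zero `g` — on the Leopoldt cell `J = (Ch_Λ X_{∅,0}).map toUnr` is principal, stub B):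
TEMPERED domination of `L` by `g` gives it. [cite: Washington1997, §7.1 Thm. 7.3] -/
theorem exists_span_pow_mul_le_of_norm_value_le_on_closedBalls {g L : UnrSeries p} (hg : g ≠ 0)
    {J : Ideal (UnrSeries p)} (hgJ : g ∈ J)
    (hdom : ∀ ρ : ℝ, ρ < 1 → ∃ (F : Set ℂ_[p]) (C : ℝ), F.Finite ∧
      ∀ x : ℂ_[p], x ∉ F → ‖x‖ ≤ ρ → ∀ u v : ℂ_[p], g.HasValueAt x u → L.HasValueAt x v →
        ‖v‖ ≤ C * ‖u‖) :
    ∃ μ : ℕ, Ideal.span {((p : ℕ) : UnrSeries p) ^ μ * L} ≤ J := by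
  obtain ⟨μ, hμ⟩ := exists_C_pow_mul_mem_span_of_norm_value_le_on_closedBalls hg hdom
  refine ⟨μ, ?_⟩
  rw [Ideal.span_singleton_le_iff_mem]
  have heq : ((p : ℕ) : UnrSeries p) ^ μ * L = PowerSeries.C (((p : ℕ) : unrIntegers p) ^ μ) * L := by
    rw [map_pow, map_natCast]
  rw [heq]
  exact ((Ideal.span_singleton_le_iff_mem _).mpr hgJ) hμ

/-! ### §4 `p = 3`: with `μ(g) = 0`, tempered domination gives K1's own `μ`-free inclusion -/

/-- **K1-shaped corollary at `p = 3`.** If `J = (g)` with `g ∈ R₀⟦T⟧` having a coefficient of norm `1` — the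
output of stub B of line `birth` on the Leopoldt cell (`(Ch_Λ X_{∅,0}).map toUnr = span{g}`, `‖g_n‖ = 1`) —
and `L` is TEMPEREDLY dominated by `g` (constants `C_ρ`, finite exceptional sets `F_ρ` on each closed ball
`‖x‖ ≤ ρ < 1`), then `span{L} ≤ J`: §3 gives `span{3^μ · L} ≤ (g)` and stub C (`…Saturation`, p595383)
removes the power of `3`. So a TEMPERED Kolyvagin-system bound + print (stub P ⟹ B) closes K1 exactly as
an integral one would. [cite: Washington1997, §7.1 Thm. 7.3] -/
theorem span_le_of_norm_value_le_on_closedBalls_of_norm_coeff_eq_one {g L : UnrSeries 3}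
    {J : Ideal (UnrSeries 3)} (hJ : J = Ideal.span {g}) {n : ℕ}
    (hn : ‖((PowerSeries.coeff n g : unrIntegers 3) : ℂ_[3])‖ = 1)
    (hdom : ∀ ρ : ℝ, ρ < 1 → ∃ (F : Set ℂ_[3]) (C : ℝ), F.Finite ∧
      ∀ x : ℂ_[3], x ∉ F → ‖x‖ ≤ ρ → ∀ u v : ℂ_[3], g.HasValueAt x u → L.HasValueAt x v →
        ‖v‖ ≤ C * ‖u‖) :
    Ideal.span {L} ≤ J := by
  have hg : g ≠ 0 := by
    intro h0
    rw [h0, map_zero, ZeroMemClass.coe_zero, norm_zero] at hn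
    exact zero_ne_one hn
  obtain ⟨μ, hμ⟩ := exists_span_pow_mul_le_of_norm_value_le_on_closedBalls hg
    (J := Ideal.span {g}) (Ideal.mem_span_singleton_self g) hdom
  rw [hJ]
  exact CumulativeHeegnerInclusionAtThreeSaturation.span_le_span_of_span_pow_three_mul_le L g μ n hn
    (by exact_mod_cast hμ)

end Summit.BirchSwinnertonDyer.BirchSwinnertonDyer.Theorems.CumulativeHeegnerInclusionAtThreeUnrSeriesTemperedDomination

end
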